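import Summits.CriticalPhenomena.PercolationContinuityZ3.Theorems.PercNearOneGluingNoHeavyLowerTailKNGoodB3Cells
import HarnessLib

/-!
# `NoHeavyLowerTail` (stmt-CriticalPhenomena-4575) — universal goodness at `|A| = 3`, B-side: THE TWO-WORLD INEQUALITIES
# IN CELL FORM (Conjecture B3 of prim-hp-2 MEMO-gen12 §6, as used by the R3 algebra)

Support file (`--supports stmt-CriticalPhenomena-4575`, hull-port prover `prim-hp-2`, gen 21).  No named facts, no sorries;
standard axioms.  For `S : KNSep.SepData` and every family `𝒬 ⊆ nullSets A` of hairless pockets: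

* `KNGoodB3.real_ev_fam`, `KNGoodB3.real_ev_Fp` — the pocket-augmented `B`-event of a cell splits as block part + `Σ_{W∈𝒬}` pockets;
* **`KNGoodB3.twoWorld12b`**: `μ([12])·(μ(d,o~a₁) + μ(d,o~a₂) + Σ_𝒬 μ(W,d)) ≤ μ(d)·(μ([12],o~a₁) + Σ_𝒬 μ(W,[12]))`;
* **`KNGoodB3.twoWorld13a`**: `μ(d)·(μ([13],o~a₂) + Σ_𝒬 μ(W,[13])) ≤ μ([13])·(μ(d,o~a₂) + Σ_𝒬 μ(W,d))`;
* **`KNGoodB3.twoWorld23a`**: `μ(d)·(μ([23],o~a₁) + Σ_𝒬 μ(W,[23])) ≤ μ([23])·(μ(d,o~a₁) + Σ_𝒬 μ(W,d))`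
(the "(I-b)" form directly from `two_world`, the "(I-a)" forms from `two_world` for the complementary family and the world
partitions `Q*_split`).  These are exactly the hypotheses `hI12b / hI13a / hI23a` (and, relabelled, the others) of
`KNGoodR3.case_low / case_mid / case_top`.
[cite: KozmaNitzan2024, §3.2 (p. 12), proof of Thm. 3 (pp. 10–12)] [cite: VandenbergHaggstromKahn2005, Thm. 1.1 (pp. 3–5)]
-/

noncomputable section

namespace Summit.CriticalPhenomena.PercolationContinuityZ3.Theorems

open MeasureTheory Set Literature.Probability.LatticeModels Literature.Probability.Percolation
open scoped Classical

namespace KNGoodB3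

open KNSep KNGoodAux KNGoodPocketBHK

variable {V : Type*} [Fintype V] (S : SepData V)

/-- The set family of a finite family of pockets. [folklore] -/
def fam (𝒬 : Finset (Finset V)) : Set (Set V) := {X | ∃ W ∈ 𝒬, X = ↑W}

/-- Members of a null family miss the relays. [folklore] -/
theorem notMem_of_nullSets {𝒬 : Finset (Finset V)} (h𝒬 : 𝒬 ⊆ nullSets (Afin S)) {W : Finset V}
    (hW : W ∈ 𝒬) {a : V} (ha : a ∈ Afin S) : a ∉ W := fun haW =>
  Finset.disjoint_left.1 (mem_nullSets.1 (h𝒬 hW)) haW ha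

/-- Members of a null family are disjoint from `A`. [folklore] -/
theorem disjoint_of_nullSets {𝒬 : Finset (Finset V)} (h𝒬 : 𝒬 ⊆ nullSets (Afin S)) {W : Finset V}
    (hW : W ∈ 𝒬) : Disjoint (↑W : Set V) S.A := by
  rw [← coe_Afin, Finset.disjoint_coe]; exact mem_nullSets.1 (h𝒬 hW)

/-- **The pocket part of a cell is the sum of its pockets**: `μ(Φ, C_B(o) ∈ 𝒬) = Σ_{W ∈ 𝒬} μ(C(o) = W, Φ)`.
[cite: KozmaNitzan2024, §3.2 (p. 12)] -/
theorem real_ev_fam (Φ : (V → V → Prop) → Prop) {𝒬 : Finset (Finset V)} (h𝒬 : 𝒬 ⊆ nullSets (Afin S)) :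
    (prodBernoulli S.w).real (S.ev fun r => Φ r ∧ {v | r S.o v} ∈ fam 𝒬) = ∑ W ∈ 𝒬, pk S Φ W := by
  have hU : S.ev (fun r => Φ r ∧ {v | r S.o v} ∈ fam 𝒬) = ⋃ W ∈ 𝒬, S.ev fun r => Φ r ∧ clPred S W r := by
    ext ω
    simp only [SepData.mem_ev, fam, Set.mem_setOf_eq, Set.mem_iUnion, clPred, exists_prop]
    constructor
    · rintro ⟨hΦ, W, hW, hX⟩
      exact ⟨W, hW, hΦ, fun v => by rw [← Finset.mem_coe, ← hX]; rfl⟩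
    · rintro ⟨W, hW, hΦ, hP⟩
      refine ⟨hΦ, W, hW, ?_⟩
      ext v; simp only [Set.mem_setOf_eq, Finset.mem_coe, hP v]
  rw [hU, measureReal_biUnion_finset _ (fun W _ => MeasurableSet.of_discrete)]
  · exact Finset.sum_congr rfl fun W hW => (pk_eq_ev S Φ (disjoint_of_nullSets S h𝒬 hW)).symm
  · intro W hW W' hW' hne
    rw [Function.onFun, Set.disjoint_left]
    rintro ω ⟨-, hP⟩ ⟨-, hP'⟩
    exact hne (by ext v; rw [← hP v, ← hP' v])

/-- **The pocket-augmented cell**: `μ(Φ, F_{xy,𝒬}) = μ(Φ, o ~ x ∨ o ~ y) + Σ_{W∈𝒬} μ(C(o)=W, Φ)` for `x, y ∈ A`.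
[cite: KozmaNitzan2024, §3.2 (p. 12)] -/
theorem real_ev_Fp (Φ : (V → V → Prop) → Prop) {x y : V} (hx : x ∈ Afin S) (hy : y ∈ Afin S)
    {𝒬 : Finset (Finset V)} (h𝒬 : 𝒬 ⊆ nullSets (Afin S)) :
    (prodBernoulli S.w).real (S.ev fun r => Φ r ∧ Fp S x y (fam 𝒬) r) =
      (prodBernoulli S.w).real (S.ev fun r => Φ r ∧ (r S.o x ∨ r S.o y)) + ∑ W ∈ 𝒬, pk S Φ W := by
  rw [← real_ev_fam S Φ h𝒬]
  have h := S.real_split_ev Set.univ (fun r => Φ r ∧ Fp S x y (fam 𝒬) r) (fun r => r S.o x ∨ r S.o y)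
  simp only [Set.univ_inter] at h
  rw [h]
  congr 2
  · ext ω; simp only [SepData.mem_ev, Fp]; tauto
  · ext ω
    simp only [SepData.mem_ev, Fp]
    constructor
    · rintro ⟨⟨hΦ, h | h⟩, hn⟩
      · exact absurd h hn
      · exact ⟨hΦ, h⟩
    · rintro ⟨hΦ, h⟩
      obtain ⟨W, hW, hX⟩ := h
      have key : ∀ {a : V}, a ∈ Afin S → ¬ S.rb ω S.o a := fun ha h' =>
        notMem_of_nullSets S h𝒬 hW ha (by rw [← Finset.mem_coe, ← hX]; exact h')
      exact ⟨⟨hΦ, Or.inr ⟨W, hW, hX⟩⟩, not_or.2 ⟨key hx, key hy⟩⟩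

omit [Fintype V] in
/-- Members of `Afin`. [folklore] -/
theorem a₁_mem_Afin : S.a₁ ∈ Afin S := by simp [Afin]
omit [Fintype V] in
/-- Members of `Afin`. [folklore] -/
theorem a₂_mem_Afin : S.a₂ ∈ Afin S := by simp [Afin]
omit [Fintype V] in
/-- Members of `Afin`. [folklore] -/
theorem a₃_mem_Afin : S.a₃ ∈ Afin S := by simp [Afin]

/-- **(I-b) for the pair `{a₁,a₂}`**: `μ([12])·(μ(d,o~a₁) + μ(d,o~a₂) + Σ_𝒬 μ(W,d)) ≤ μ(d)·(μ([12],o~a₁) + Σ_𝒬 μ(W,[12]))`.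
[cite: KozmaNitzan2024, §3.2 (p. 12), proof of Thm. 3 (pp. 10–11)] -/
theorem twoWorld12b {𝒬 : Finset (Finset V)} (h𝒬 : 𝒬 ⊆ nullSets (Afin S)) :
    (prodBernoulli S.w).real (S.ev S.c12) *
        ((prodBernoulli S.w).real (S.ev fun r => S.cM r ∧ r S.o S.a₁) +
          (prodBernoulli S.w).real (S.ev fun r => S.cM r ∧ r S.o S.a₂) + ∑ W ∈ 𝒬, pk S S.cM W) ≤
      (prodBernoulli S.w).real (S.ev S.cM) *
        ((prodBernoulli S.w).real (S.ev fun r => S.c12 r ∧ r S.o S.a₁) + ∑ W ∈ 𝒬, pk S S.c12 W) := by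
  have hQ : ∀ W' ∈ fam 𝒬, S.a₃ ∉ W' := by
    rintro W' ⟨W, hW, rfl⟩ h
    exact notMem_of_nullSets S h𝒬 hW (a₃_mem_Afin S) (Finset.mem_coe.1 h)
  have key := two_world S S.a₁ S.a₂ S.a₃ (fam 𝒬) hQ
  have e1 : S.ev (fun r => r S.a₁ S.a₂ ∧ Dp S.a₁ S.a₂ S.a₃ r) = S.ev S.c12 := by
    ext ω; simp only [SepData.mem_ev, Dp, SepData.c12]
    exact ⟨fun ⟨h12, h13, _⟩ => ⟨h12, h13⟩, fun ⟨h12, h13⟩ => ⟨h12, h13, fun h23 => h13 (rB.trans h12 h23)⟩⟩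
  have e2 : S.ev (fun r => ¬ r S.a₁ S.a₂ ∧ Dp S.a₁ S.a₂ S.a₃ r) = S.ev S.cM := by
    ext ω; simp only [SepData.mem_ev, Dp, SepData.cM]
  have e3 : S.ev (fun r => (¬ r S.a₁ S.a₂ ∧ Dp S.a₁ S.a₂ S.a₃ r) ∧ Fp S S.a₁ S.a₂ (fam 𝒬) r) =
      S.ev (fun r => S.cM r ∧ Fp S S.a₁ S.a₂ (fam 𝒬) r) := by
    ext ω; simp only [SepData.mem_ev, Dp, SepData.cM]
  have e4 : S.ev (fun r => (r S.a₁ S.a₂ ∧ Dp S.a₁ S.a₂ S.a₃ r) ∧ Fp S S.a₁ S.a₂ (fam 𝒬) r) =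
      S.ev (fun r => S.c12 r ∧ Fp S S.a₁ S.a₂ (fam 𝒬) r) := by
    ext ω; simp only [SepData.mem_ev, Dp, SepData.c12]
    constructor
    · rintro ⟨⟨h12, h13, -⟩, hF⟩; exact ⟨⟨h12, h13⟩, hF⟩
    · rintro ⟨⟨h12, h13⟩, hF⟩; exact ⟨⟨h12, h13, fun h23 => h13 (rB.trans h12 h23)⟩, hF⟩
  rw [e1, e2, e3, e4, real_ev_Fp S S.cM (a₁_mem_Afin S) (a₂_mem_Afin S) h𝒬,
    real_ev_Fp S S.c12 (a₁_mem_Afin S) (a₂_mem_Afin S) h𝒬] at key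
  -- under `d` the two hairs are exclusive; under `[12]` they coincide
  have sM := S.real_split_ev Set.univ (fun r => S.cM r ∧ (r S.o S.a₁ ∨ r S.o S.a₂)) (fun r => r S.o S.a₁)
  simp only [Set.univ_inter] at sM
  have f1 : S.ev (fun r => (S.cM r ∧ (r S.o S.a₁ ∨ r S.o S.a₂)) ∧ r S.o S.a₁) = S.ev fun r => S.cM r ∧ r S.o S.a₁ := by
    ext ω; simp only [SepData.mem_ev]; tauto
  have f2 : S.ev (fun r => (S.cM r ∧ (r S.o S.a₁ ∨ r S.o S.a₂)) ∧ ¬ r S.o S.a₁) = S.ev fun r => S.cM r ∧ r S.o S.a₂ := by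
    ext ω; simp only [SepData.mem_ev, SepData.cM]
    constructor
    · rintro ⟨⟨h, h1 | h2⟩, hn⟩
      · exact absurd h1 hn
      · exact ⟨h, h2⟩
    · rintro ⟨h, h2⟩; exact ⟨⟨h, Or.inr h2⟩, fun h1 => h.1 (rB.trans (rB.symm h1) h2)⟩
  have f3 : S.ev (fun r => S.c12 r ∧ (r S.o S.a₁ ∨ r S.o S.a₂)) = S.ev fun r => S.c12 r ∧ r S.o S.a₁ := by
    ext ω; simp only [SepData.mem_ev, SepData.c12]
    constructor
    · rintro ⟨h, h1 | h2⟩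
      · exact ⟨h, h1⟩
      · exact ⟨h, rB.trans h2 (rB.symm h.1)⟩
    · rintro ⟨h, h1⟩; exact ⟨h, Or.inl h1⟩
  rw [sM, f1, f2, f3] at key
  exact key

/-- The sum over all pockets splits along a sub-family. [folklore] -/
theorem sum_nullSets_split (f : Finset V → ℝ) {𝒬 : Finset (Finset V)} (h𝒬 : 𝒬 ⊆ nullSets (Afin S)) :
    ∑ W ∈ nullSets (Afin S), f W = ∑ W ∈ 𝒬, f W + ∑ W ∈ nullSets (Afin S) \ 𝒬, f W := by
  rw [← Finset.sum_union Finset.disjoint_sdiff, Finset.union_sdiff_of_subset h𝒬]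

/-- **(I-a) for the pair `{a₁,a₃}` with the lonely relay `a₂`**:
`μ(d)·(μ([13],o~a₂) + Σ_𝒬 μ(W,[13])) ≤ μ([13])·(μ(d,o~a₂) + Σ_𝒬 μ(W,d))`.
[cite: KozmaNitzan2024, §3.2 (p. 12), proof of Thm. 3 (pp. 10–11)] -/
theorem twoWorld13a {𝒬 : Finset (Finset V)} (h𝒬 : 𝒬 ⊆ nullSets (Afin S)) :
    (prodBernoulli S.w).real (S.ev S.cM) *
        ((prodBernoulli S.w).real (S.ev fun r => S.c13 r ∧ r S.o S.a₂) + ∑ W ∈ 𝒬, pk S S.c13 W) ≤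
      (prodBernoulli S.w).real (S.ev S.c13) *
        ((prodBernoulli S.w).real (S.ev fun r => S.cM r ∧ r S.o S.a₂) + ∑ W ∈ 𝒬, pk S S.cM W) := by
  set 𝒬c := nullSets (Afin S) \ 𝒬 with h𝒬c
  have h𝒬c' : 𝒬c ⊆ nullSets (Afin S) := Finset.sdiff_subset
  have hQ : ∀ W' ∈ fam 𝒬c, S.a₂ ∉ W' := by
    rintro W' ⟨W, hW, rfl⟩ h
    exact notMem_of_nullSets S h𝒬c' hW (a₂_mem_Afin S) (Finset.mem_coe.1 h)
  have key := two_world S S.a₁ S.a₃ S.a₂ (fam 𝒬c) hQ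
  have e1 : S.ev (fun r => r S.a₁ S.a₃ ∧ Dp S.a₁ S.a₃ S.a₂ r) = S.ev S.c13 := by
    ext ω; simp only [SepData.mem_ev, Dp, SepData.c13]
    exact ⟨fun ⟨h13, h12, _⟩ => ⟨h12, h13⟩,
      fun ⟨h12, h13⟩ => ⟨h13, h12, fun h32 => h12 (rB.trans h13 h32)⟩⟩
  have e2 : S.ev (fun r => ¬ r S.a₁ S.a₃ ∧ Dp S.a₁ S.a₃ S.a₂ r) = S.ev S.cM := by
    ext ω; simp only [SepData.mem_ev, Dp, SepData.cM]
    exact ⟨fun ⟨h13, h12, h32⟩ => ⟨h12, h13, fun h23 => h32 (rB.symm h23)⟩,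
      fun ⟨h12, h13, h23⟩ => ⟨h13, h12, fun h32 => h23 (rB.symm h32)⟩⟩
  have e3 : S.ev (fun r => (¬ r S.a₁ S.a₃ ∧ Dp S.a₁ S.a₃ S.a₂ r) ∧ Fp S S.a₁ S.a₃ (fam 𝒬c) r) =
      S.ev (fun r => S.cM r ∧ Fp S S.a₁ S.a₃ (fam 𝒬c) r) := by
    ext ω; simp only [SepData.mem_ev, Dp, SepData.cM]
    exact ⟨fun ⟨⟨h13, h12, h32⟩, hF⟩ => ⟨⟨h12, h13, fun h23 => h32 (rB.symm h23)⟩, hF⟩,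
      fun ⟨⟨h12, h13, h23⟩, hF⟩ => ⟨⟨h13, h12, fun h32 => h23 (rB.symm h32)⟩, hF⟩⟩
  have e4 : S.ev (fun r => (r S.a₁ S.a₃ ∧ Dp S.a₁ S.a₃ S.a₂ r) ∧ Fp S S.a₁ S.a₃ (fam 𝒬c) r) =
      S.ev (fun r => S.c13 r ∧ Fp S S.a₁ S.a₃ (fam 𝒬c) r) := by
    ext ω; simp only [SepData.mem_ev, Dp, SepData.c13]
    exact ⟨fun ⟨⟨h13, h12, _⟩, hF⟩ => ⟨⟨h12, h13⟩, hF⟩,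
      fun ⟨⟨h12, h13⟩, hF⟩ => ⟨⟨h13, h12, fun h32 => h12 (rB.trans h13 h32)⟩, hF⟩⟩
  rw [e1, e2, e3, e4, real_ev_Fp S S.cM (a₁_mem_Afin S) (a₃_mem_Afin S) h𝒬c',
    real_ev_Fp S S.c13 (a₁_mem_Afin S) (a₃_mem_Afin S) h𝒬c'] at key
  have sM := S.real_split_ev Set.univ (fun r => S.cM r ∧ (r S.o S.a₁ ∨ r S.o S.a₃)) (fun r => r S.o S.a₁)
  simp only [Set.univ_inter] at sM
  have f1 : S.ev (fun r => (S.cM r ∧ (r S.o S.a₁ ∨ r S.o S.a₃)) ∧ r S.o S.a₁) = S.ev fun r => S.cM r ∧ r S.o S.a₁ := by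
    ext ω; simp only [SepData.mem_ev]; tauto
  have f2 : S.ev (fun r => (S.cM r ∧ (r S.o S.a₁ ∨ r S.o S.a₃)) ∧ ¬ r S.o S.a₁) = S.ev fun r => S.cM r ∧ r S.o S.a₃ := by
    ext ω; simp only [SepData.mem_ev, SepData.cM]
    constructor
    · rintro ⟨⟨h, h1 | h3⟩, hn⟩
      · exact absurd h1 hn
      · exact ⟨h, h3⟩
    · rintro ⟨h, h3⟩; exact ⟨⟨h, Or.inr h3⟩, fun h1 => h.2.1 (rB.trans (rB.symm h1) h3)⟩
  have f3 : S.ev (fun r => S.c13 r ∧ (r S.o S.a₁ ∨ r S.o S.a₃)) = S.ev fun r => S.c13 r ∧ r S.o S.a₁ := by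
    ext ω; simp only [SepData.mem_ev, SepData.c13]
    constructor
    · rintro ⟨h, h1 | h3⟩
      · exact ⟨h, h1⟩
      · exact ⟨h, rB.trans h3 (rB.symm h.2)⟩
    · rintro ⟨h, h1⟩; exact ⟨h, Or.inl h1⟩
  rw [sM, f1, f2, f3] at key
  have tM := QM_split S
  have t13 := Q13_split S
  rw [sum_nullSets_split S (pk S S.cM) h𝒬] at tM
  rw [sum_nullSets_split S (pk S S.c13) h𝒬] at t13
  have hm : (prodBernoulli S.w).real (S.ev fun r => S.cM r ∧ r S.o S.a₁) +
      (prodBernoulli S.w).real (S.ev fun r => S.cM r ∧ r S.o S.a₃) + ∑ W ∈ 𝒬c, pk S S.cM W =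
      (prodBernoulli S.w).real (S.ev S.cM) - (prodBernoulli S.w).real (S.ev fun r => S.cM r ∧ r S.o S.a₂) -
        ∑ W ∈ 𝒬, pk S S.cM W := by rw [h𝒬c]; linarith
  have hm' : (prodBernoulli S.w).real (S.ev fun r => S.c13 r ∧ r S.o S.a₁) + ∑ W ∈ 𝒬c, pk S S.c13 W =
      (prodBernoulli S.w).real (S.ev S.c13) - (prodBernoulli S.w).real (S.ev fun r => S.c13 r ∧ r S.o S.a₂) -
        ∑ W ∈ 𝒬, pk S S.c13 W := by rw [h𝒬c]; linarith
  rw [hm, hm'] at key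
  ring_nf at key ⊢
  linarith

/-- **(I-a) for the pair `{a₂,a₃}` with the lonely relay `a₁`**:
`μ(d)·(μ([23],o~a₁) + Σ_𝒬 μ(W,[23])) ≤ μ([23])·(μ(d,o~a₁) + Σ_𝒬 μ(W,d))`.
[cite: KozmaNitzan2024, §3.2 (p. 12), proof of Thm. 3 (pp. 10–11)] -/
theorem twoWorld23a {𝒬 : Finset (Finset V)} (h𝒬 : 𝒬 ⊆ nullSets (Afin S)) :
    (prodBernoulli S.w).real (S.ev S.cM) *
        ((prodBernoulli S.w).real (S.ev fun r => S.c23 r ∧ r S.o S.a₁) + ∑ W ∈ 𝒬, pk S S.c23 W) ≤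
      (prodBernoulli S.w).real (S.ev S.c23) *
        ((prodBernoulli S.w).real (S.ev fun r => S.cM r ∧ r S.o S.a₁) + ∑ W ∈ 𝒬, pk S S.cM W) := by
  set 𝒬c := nullSets (Afin S) \ 𝒬 with h𝒬c
  have h𝒬c' : 𝒬c ⊆ nullSets (Afin S) := Finset.sdiff_subset
  have hQ : ∀ W' ∈ fam 𝒬c, S.a₁ ∉ W' := by
    rintro W' ⟨W, hW, rfl⟩ h
    exact notMem_of_nullSets S h𝒬c' hW (a₁_mem_Afin S) (Finset.mem_coe.1 h)
  have key := two_world S S.a₂ S.a₃ S.a₁ (fam 𝒬c) hQ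
  have e1 : S.ev (fun r => r S.a₂ S.a₃ ∧ Dp S.a₂ S.a₃ S.a₁ r) = S.ev S.c23 := by
    ext ω; simp only [SepData.mem_ev, Dp, SepData.c23]
    exact ⟨fun ⟨h23, h21, h31⟩ => ⟨fun h12 => h21 (rB.symm h12), fun h13 => h31 (rB.symm h13), h23⟩,
      fun ⟨h12, h13, h23⟩ => ⟨h23, fun h21 => h12 (rB.symm h21), fun h31 => h13 (rB.symm h31)⟩⟩
  have e2 : S.ev (fun r => ¬ r S.a₂ S.a₃ ∧ Dp S.a₂ S.a₃ S.a₁ r) = S.ev S.cM := by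
    ext ω; simp only [SepData.mem_ev, Dp, SepData.cM]
    exact ⟨fun ⟨h23, h21, h31⟩ => ⟨fun h12 => h21 (rB.symm h12), fun h13 => h31 (rB.symm h13), h23⟩,
      fun ⟨h12, h13, h23⟩ => ⟨h23, fun h21 => h12 (rB.symm h21), fun h31 => h13 (rB.symm h31)⟩⟩
  have e3 : S.ev (fun r => (¬ r S.a₂ S.a₃ ∧ Dp S.a₂ S.a₃ S.a₁ r) ∧ Fp S S.a₂ S.a₃ (fam 𝒬c) r) =
      S.ev (fun r => S.cM r ∧ Fp S S.a₂ S.a₃ (fam 𝒬c) r) := by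
    ext ω; simp only [SepData.mem_ev, Dp, SepData.cM]
    exact ⟨fun ⟨⟨h23, h21, h31⟩, hF⟩ => ⟨⟨fun h12 => h21 (rB.symm h12), fun h13 => h31 (rB.symm h13), h23⟩, hF⟩,
      fun ⟨⟨h12, h13, h23⟩, hF⟩ => ⟨⟨h23, fun h21 => h12 (rB.symm h21), fun h31 => h13 (rB.symm h31)⟩, hF⟩⟩
  have e4 : S.ev (fun r => (r S.a₂ S.a₃ ∧ Dp S.a₂ S.a₃ S.a₁ r) ∧ Fp S S.a₂ S.a₃ (fam 𝒬c) r) =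
      S.ev (fun r => S.c23 r ∧ Fp S S.a₂ S.a₃ (fam 𝒬c) r) := by
    ext ω; simp only [SepData.mem_ev, Dp, SepData.c23]
    exact ⟨fun ⟨⟨h23, h21, h31⟩, hF⟩ => ⟨⟨fun h12 => h21 (rB.symm h12), fun h13 => h31 (rB.symm h13), h23⟩, hF⟩,
      fun ⟨⟨h12, h13, h23⟩, hF⟩ => ⟨⟨h23, fun h21 => h12 (rB.symm h21), fun h31 => h13 (rB.symm h31)⟩, hF⟩⟩
  rw [e1, e2, e3, e4, real_ev_Fp S S.cM (a₂_mem_Afin S) (a₃_mem_Afin S) h𝒬c',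
    real_ev_Fp S S.c23 (a₂_mem_Afin S) (a₃_mem_Afin S) h𝒬c'] at key
  have sM := S.real_split_ev Set.univ (fun r => S.cM r ∧ (r S.o S.a₂ ∨ r S.o S.a₃)) (fun r => r S.o S.a₂)
  simp only [Set.univ_inter] at sM
  have f1 : S.ev (fun r => (S.cM r ∧ (r S.o S.a₂ ∨ r S.o S.a₃)) ∧ r S.o S.a₂) = S.ev fun r => S.cM r ∧ r S.o S.a₂ := by
    ext ω; simp only [SepData.mem_ev]; tauto
  have f2 : S.ev (fun r => (S.cM r ∧ (r S.o S.a₂ ∨ r S.o S.a₃)) ∧ ¬ r S.o S.a₂) = S.ev fun r => S.cM r ∧ r S.o S.a₃ := by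
    ext ω; simp only [SepData.mem_ev, SepData.cM]
    constructor
    · rintro ⟨⟨h, h2 | h3⟩, hn⟩
      · exact absurd h2 hn
      · exact ⟨h, h3⟩
    · rintro ⟨h, h3⟩; exact ⟨⟨h, Or.inr h3⟩, fun h2 => h.2.2 (rB.trans (rB.symm h2) h3)⟩
  have f3 : S.ev (fun r => S.c23 r ∧ (r S.o S.a₂ ∨ r S.o S.a₃)) = S.ev fun r => S.c23 r ∧ r S.o S.a₂ := by
    ext ω; simp only [SepData.mem_ev, SepData.c23]
    constructor
    · rintro ⟨h, h2 | h3⟩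
      · exact ⟨h, h2⟩
      · exact ⟨h, rB.trans h3 (rB.symm h.2.2)⟩
    · rintro ⟨h, h2⟩; exact ⟨h, Or.inl h2⟩
  rw [sM, f1, f2, f3] at key
  have tM := QM_split S
  have t23 := Q23_split S
  rw [sum_nullSets_split S (pk S S.cM) h𝒬] at tM
  rw [sum_nullSets_split S (pk S S.c23) h𝒬] at t23
  have hm : (prodBernoulli S.w).real (S.ev fun r => S.cM r ∧ r S.o S.a₂) +
      (prodBernoulli S.w).real (S.ev fun r => S.cM r ∧ r S.o S.a₃) + ∑ W ∈ 𝒬c, pk S S.cM W =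
      (prodBernoulli S.w).real (S.ev S.cM) - (prodBernoulli S.w).real (S.ev fun r => S.cM r ∧ r S.o S.a₁) -
        ∑ W ∈ 𝒬, pk S S.cM W := by rw [h𝒬c]; linarith
  have hm' : (prodBernoulli S.w).real (S.ev fun r => S.c23 r ∧ r S.o S.a₂) + ∑ W ∈ 𝒬c, pk S S.c23 W =
      (prodBernoulli S.w).real (S.ev S.c23) - (prodBernoulli S.w).real (S.ev fun r => S.c23 r ∧ r S.o S.a₁) -
        ∑ W ∈ 𝒬, pk S S.c23 W := by rw [h𝒬c]; linarith
  rw [hm, hm'] at key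
  ring_nf at key ⊢
  linarith

end KNGoodB3

end Summit.CriticalPhenomena.PercolationContinuityZ3.Theorems
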